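import Literature.Computability.Cryptography.BLPRSSection4Assembly
import Literature.Computability.Cryptography.BLPRSSection4CapParams
import Literature.Computability.Cryptography.LWEBinaryNoiseInstantiation
import Literature.Computability.Cryptography.LWEBinaryLHLBridge
import HarnessLib

/-!
# BLPRS 2013, §3–§4 at the level of laws in the regime of pqc.S21: the capstone (modulo Lemma 4.7)

Topic `Computability/Cryptography` (LWE), grouping namespace `BLPRS2013`. Proved glue (no named fact) towards
`Literature.Computability.Cryptography.blprs_gapSVP_sqrt_dim_to_lwe_classical` (**pqc.S21**), hypothesis `h₃` of
`BLPRSReduction.lean`: the law-level chain `section4_selected` (`BLPRSSection4Assembly.lean`: Thm. 4.1's bookkeeping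
with Lemma 4.7 as hypothesis, Cor. 3.2, Lemma 2.15, transport and selection) RUN WITH THE PARAMETERS of
`BLPRSSection4Params.lean` / `BLPRSSection4GridParams.lean` / `BLPRSSection4CapParams.lean` and the first hybrid's
Gaussian noise of approach B (`LWE.latticeNoiseLaw (invScaledBasisZ n Q) (√5·α₂)` with `χ_h = Ψ̄_Q(√(5n)·α₂)`,
`LWEBinaryNoiseInstantiation.lean`; binary secret `LWE.binaryIntLaw`, leftover-hash term `LWEBinaryLHLBridge.lean`):

* `binaryIntLaw_support_binary`, `binNoiseRate_intCastVec_eq` (for binary `z`, `ρ₀(z̄) = √(‖z‖²(√5α₂)² + (√(5n)α₂)²)`),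
  `sqrt_rate₂_sq_add_raise_sq` (`√(α₂² + u²) = √(5n)·α₂` for `u = α₂√(5n-1)`);
* **`section4_law_eventually`** — for every polynomially bounded `q, m₃`, admissible `α` (`0 < α < 1`, `αq ≥ √n·ln n`
  eventually) and exponent `c₃`, and GIVEN Lemma 4.7 at every inverse-polynomial loss (hypothesis `h47`, approach B's
  remaining step), there are exponents `c', c_D` such that for all large `n`: every test `K` of `m₃(n) ≥ 1` samples of
  `LWE_{n,q,Ψ̄_α}` with advantage `≥ 1/n^{c₃}` yields a test of `LWE_{d,Q,Ψ̄_{α₂}}` on `max m m_fel` samples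
  (`m = sampleCount`) with advantage `≥ 1/n^{c'}` — the ideal law the finite-precision machine of `h₃` will be compared with.

## References

* Z. Brakerski, A. Langlois, C. Peikert, O. Regev, D. Stehlé, *Classical hardness of learning with errors*, STOC 2013;
  arXiv:1306.0281, p. 13 (the formal Thm. 1.1: Thm. 4.1 + Cor. 3.2 + Lemma 2.15, all losses `1/poly`), Thm. 4.1 (proof),
  Lemmas 2.2, 2.9, 4.3, 4.7, 4.9. [BrakerskiEtAl2013]
* O. Regev, *On lattices, learning with errors …*, J. ACM 56 (2009), Lemma 4.1, Claim 2.2. [RegevLWE2009]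
-/

noncomputable section

open Filter MeasureTheory Literature.Algebra.EuclideanLattices Literature.Probability.Distributions
  Literature.Computability.Complexity
open scoped Real ENNReal

namespace Literature.Computability.Cryptography

namespace BLPRS2013

open LWE LWE.MP12

/-! ### Small bridges -/

/-- The uniform binary law is supported on binary vectors. [cite: BrakerskiEtAl2013, Def. 2.11] -/
theorem binaryIntLaw_support_binary {Q n : ℕ} [NeZero Q] (hQ : 1 < Q) {z : Fin n → ℤ}
    (hz : z ∈ (binaryIntLaw Q n).support) (j : Fin n) : z j = 0 ∨ z j = 1 := by
  rw [binaryIntLaw, PMF.support_map] at hz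
  obtain ⟨s, hs, rfl⟩ := hz
  rw [PMF.mem_support_uniformOfFinset_iff, Finset.mem_filter] at hs
  haveI : Fact (1 < Q) := ⟨hQ⟩
  rcases hs.2 j with h | h
  · left; simp [h]
  · right; simp [h, ZMod.val_one]

/-- **For a binary secret, `ρ₀(z̄)` is the first hybrid's Gaussian parameter**:
`binNoiseRate α n z̄ = √(‖z‖²·(√5α₂)² + (√(5n)α₂)²)`. [cite: BrakerskiEtAl2013, Lemma 4.9 (`α' = √(β²‖z‖² + γ²)`)] -/
theorem binNoiseRate_intCastVec_eq {α : ℕ → ℝ} {n : ℕ} {z : Fin n → ℤ} (hz : ∀ j, z j = 0 ∨ z j = 1) :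
    binNoiseRate α n (intCastVec z) =
      Real.sqrt (‖WithLp.toLp 2 (fun j => (z j : ℝ))‖ ^ 2 * (Real.sqrt 5 * rate₂ α n) ^ 2 + (Real.sqrt (5 * n) * rate₂ α n) ^ 2) := by
  have hnorm : ‖WithLp.toLp 2 (fun j => (z j : ℝ))‖ ^ 2 = (hammingNorm (intCastVec z : Fin n → ZMod (modulus n)) : ℝ) := by
    rw [← norm_sq_intVecToEuclidean_of_binary (one_lt_modulus n) hz]
    rfl
  unfold binNoiseRate
  congr 1
  rw [hnorm, mul_pow, mul_pow, Real.sq_sqrt (by norm_num), Real.sq_sqrt (by positivity)]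
  ring

/-- `√(α₂² + u²) = √(5n)·α₂` for the raising `u = α₂·√(5n - 1)` (`n ≥ 1`, `α₂ ≥ 0`). [cite: BrakerskiEtAl2013, Thm. 4.1 (proof: branch 2, `α ↦ √(5n)α`)] -/
theorem sqrt_rate₂_sq_add_raise_sq {a : ℝ} (ha : 0 ≤ a) {n : ℕ} (hn : 1 ≤ n) :
    Real.sqrt (a ^ 2 + (a * Real.sqrt (5 * n - 1)) ^ 2) = Real.sqrt (5 * n) * a := by
  have hn' : (1 : ℝ) ≤ n := by exact_mod_cast hn
  rw [mul_pow, Real.sq_sqrt (by linarith), show a ^ 2 + a ^ 2 * (5 * n - 1) = (5 * n) * a ^ 2 by ring,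
    Real.sqrt_mul (by positivity), Real.sqrt_sq ha]

/-! ### The capstone -/

section Capstone

variable {q : ℕ → ℕ} [∀ n, NeZero (q n)] {α : ℕ → ℝ} {m₃ : ℕ → ℕ}

/-- **BLPRS §3–§4 at the level of laws, in the regime of pqc.S21, modulo Lemma 4.7.** For polynomially bounded `q, m₃`,
admissible `α` and every `c₃`, given Lemma 4.7 at every inverse-polynomial loss (`h47`), there are `c', c_D` such
that for all large `n`, every test `K` of `m₃(n) ≥ 1` samples of `LWE_{n,q,Ψ̄_α}` with uniform secret and advantage
`≥ 1/n^{c₃}` yields a test `D` of `LWE_{⌊√n⌋, Q, Ψ̄_{α₂}}` (`Q = 2^{⌊d/2⌋+2}`, `α₂ = α/(8d)`) on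
`max (sampleCount q m₃ c_D c₃ n) (m_fel n)` samples with advantage `≥ 1/n^{c'}`.
[cite: BrakerskiEtAl2013, p. 13 (Thm. 4.1 + Cor. 3.2 + Lemma 2.15) with Thm. 4.1 (proof); RegevLWE2009, Lemma 4.1] -/
theorem section4_law_eventually (hq : IsPolyBounded q) (hm : IsPolyBounded m₃)
    (hα : ∀ᶠ n : ℕ in atTop, 0 < α n ∧ α n < 1 ∧ Real.sqrt n * Real.log n ≤ α n * q n) (c₃ : ℕ) (mfel : ℕ → ℕ)
    (h47 : ∀ c₄₇ : ℕ, ∀ᶠ n : ℕ in atTop, ∀ ζ' : PMF (Fin n → ℤ), (∀ z ∈ ζ'.support, ∀ i, z i = 0 ∨ z i = 1) →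
      ∀ D : (Fin n → ℤ) × (Matrix (Fin (dim n + 1)) (Fin n) (ZMod (modulus n)) × (Fin 1 → (Fin n → ZMod (modulus n)) × ℤ)) → PMF Bool,
        ∃ D' : ((Fin (dim n + 1) → ZMod (modulus n)) × ZMod (modulus n)) ×
            (Fin (mfel n) → (Fin (dim n + 1) → ZMod (modulus n)) × ZMod (modulus n)) → PMF Bool,
          extLWEAdvantageZ ζ' (latticeNoiseLaw (invScaledBasisZ n (modulus n)) (Real.sqrt 5 * rate₂ α n)) 1 D ≤
            felAdvantage (discretizedGaussian (modulus n) (rate₂ α n)) (mfel n) D' + 1 / (n : ℝ) ^ c₄₇) :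
    ∃ c' cD : ℕ, ∀ᶠ n : ℕ in atTop, 0 < m₃ n →
      ∀ K : (Fin (m₃ n) → (Fin n → ZMod (q n)) × ZMod (q n)) → PMF Bool,
        1 / (n : ℝ) ^ c₃ ≤ distinguishingAdvantage (discretizedGaussian (q n) (α n)) (m₃ n) K →
        ∃ D : Distinguisher (Fin (dim n)) (ZMod (modulus n)) (max (sampleCount q m₃ cD c₃ n) (mfel n)),
          1 / (n : ℝ) ^ c' ≤ distinguishingAdvantage (discretizedGaussian (modulus n) (rate₂ α n)) _ D := by
  -- the exponents
  obtain ⟨cD, hcD⟩ := eventually_threshold_budget (q := q) hm c₃ hα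
  obtain ⟨c₀, hc₀⟩ := eventually_eps_terms (m₃ := m₃) hm (c₃ + 1)
  obtain ⟨c₄₇, hc₄₇⟩ := eventually_ell_term hq hm cD c₃
  obtain ⟨c', hc'⟩ := eventually_final_advantage hq hm cD c₃
  -- `ε = n^{-(c₀+1)}` (so that `ε ≤ 1/8` and the `ε`-terms still fit)
  obtain ⟨c, hcdef⟩ : ∃ c : ℕ, c = c₀ + 1 := ⟨_, rfl⟩
  refine ⟨c', cD, ?_⟩
  obtain ⟨pq, hpq⟩ := hq
  have hqQ := eventually_mul_eval_le_two_pow_half_dim pq 1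
  filter_upwards [hcD, hc₀, hc₄₇, hc', hqQ, eventually_modulus_term ⟨pq, hpq⟩ hm (c₃ + 1) hα,
    eventually_noise_smoothing (α := α) ⟨pq, hpq⟩ c hα, eventually_lhl_condition c,
    eventually_raise_term (α := α) ⟨pq, hpq⟩ hm cD c₃ hα, eventually_grid_guess (q := q) (α := α) c cD hα,
    h47 c₄₇, eventually_inv_rate_le hα, eventually_ge_atTop 8]
    with n hthr heps hell hfin hqQn hmod hsmooth hlhl hraise hguess h47n hinv h8 hm₃pos K hK
  obtain ⟨hα0, hα1, h1αq, -⟩ := hinv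
  have hn : 0 < n := by omega
  have h4 : 4 ≤ n := by omega
  have hn8 : (8 : ℝ) ≤ n := by exact_mod_cast h8
  have hn0 : (0 : ℝ) < n := by linarith
  have hq0 : 0 < q n := Nat.pos_of_ne_zero (NeZero.ne (q n))
  have hq0' : (0 : ℝ) < q n := by exact_mod_cast hq0
  -- `q ≤ Q`
  have hqQ' : q n ≤ modulus n := by
    have h1 : (1 : ℝ) * ((pq.eval n : ℕ) : ℝ) ≤ (2 : ℝ) ^ (dim n / 2) := hqQn
    have h2 : ((2 : ℝ) ^ (dim n / 2)) ≤ modulus n := by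
      unfold modulus; push_cast; rw [pow_add]
      have : (0 : ℝ) < (2 : ℝ) ^ (dim n / 2) := by positivity
      nlinarith
    have h3 : ((q n : ℕ) : ℝ) ≤ ((pq.eval n : ℕ) : ℝ) := by exact_mod_cast hpq n
    have h4' : ((q n : ℕ) : ℝ) ≤ modulus n := by linarith
    exact_mod_cast h4'
  -- the quantities
  set ε : ℝ := 1 / (n : ℝ) ^ c with hεdef
  set θ : ℝ := advThreshold (c₃ + 1) n with hθdef
  set α₂ : ℝ := rate₂ α n with hα₂def
  set r : ℝ := gridRadius q c n with hrdef
  set G : ℕ := gridG q cD n with hGdef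
  set D : ℕ := gridD cD n with hDdef
  set N : ℕ := gridBatches q cD c₃ n with hNdef
  have hε : 0 < ε := by rw [hεdef]; positivity
  have hεc₀ : ε ≤ 1 / (n : ℝ) ^ c₀ := by
    rw [hεdef, hcdef]
    exact one_div_le_one_div_of_le (by positivity) (pow_le_pow_right₀ (by linarith) (by omega))
  have hε8 : ε ≤ 1 / 8 := by
    rw [hεdef, hcdef]
    refine one_div_le_one_div_of_le (by norm_num) ?_
    calc (8 : ℝ) ≤ n := hn8
      _ = (n : ℝ) ^ 1 := (pow_one _).symm
      _ ≤ (n : ℝ) ^ (c₀ + 1) := pow_le_pow_right₀ (by linarith) (by omega)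
  have hε' : ε ≤ 1 / 2 := hε8.trans (by norm_num)
  have hθ : 0 < θ := advThreshold_pos hn
  have hα₂ : 0 < α₂ := by
    rw [hα₂def]
    exact lt_of_lt_of_le (by positivity) (rate₂_ge_inv hn hq0' h1αq)
  have hα₀ : 0 < Real.sqrt (5 * n) * α₂ := by positivity
  have hG : 0 < G := gridG_pos cD n
  have hN : 0 < N := gridBatches_pos hn
  have hmcount : 0 < sampleCount q m₃ cD c₃ n := sampleCount_pos hn hm₃pos
  have hNsel : 0 < selRuns q m₃ cD c₃ n := by unfold selRuns; positivity
  -- `hr`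
  have hr : max ((modulus n : ℝ))⁻¹ ((q n : ℝ))⁻¹ * Real.sqrt (2 * Real.log (2 * n * (1 + 1 / ε)) / π) ≤ r :=
    (switchRadius_spec (c := c) hq0 hqQ').trans (switchRadius_le_gridRadius h4 hq0)
  -- the guess clause from `hK`
  have hKz : ∀ z ∈ (binaryIntLaw (modulus n) n).support, ‖intVecToEuclidean n z‖ ≤ Real.sqrt n ∧
      Real.sqrt (5 * n) * α₂ ≤ binNoiseRate α n (intCastVec z) ∧
      ∃ w : Fin G, 4 * θ ≤ distinguishingAdvantage (discretizedGaussian (q n)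
        (Real.sqrt (Real.sqrt (binNoiseRate α n (intCastVec z) ^ 2 + r ^ 2 * (‖intVecToEuclidean n z‖ ^ 2 + Real.sqrt n ^ 2)) ^ 2 +
          gridTau (q n) ((q n : ℝ) * r * Real.sqrt n / √π) D G w ^ 2))) (m₃ n) K := by
    intro z hz
    have hzb : ∀ j, z j = 0 ∨ z j = 1 := binaryIntLaw_support_binary (one_lt_modulus n) hz
    refine ⟨norm_intVecToEuclidean_le_sqrt_of_binary hzb, binNoiseRate_ge hα₂.le _, ?_⟩
    obtain ⟨i, -, hclose⟩ := hguess z hzb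
    refine ⟨i, four_theta_le_adv_of_tvDist_le K ?_ hclose⟩
    exact hthr.trans hK
  -- the `ε`-terms and the modulus term
  have hεθ : (m₃ n : ℝ) * (4 * ε) ≤ θ / 2 := by
    refine le_trans ?_ heps.1
    exact mul_le_mul_of_nonneg_left (mul_le_mul_of_nonneg_left hεc₀ (by norm_num)) (Nat.cast_nonneg _)
  have hQθ : (m₃ n : ℝ) * (2 / (Real.sqrt (5 * n) * α₂ * modulus n) + 10 * ε) + (m₃ n : ℝ) * (4 * ε) ≤ 2 * θ := by
    have h14 : (m₃ n : ℝ) * (14 * ε) ≤ θ := by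
      refine le_trans ?_ heps.2
      exact mul_le_mul_of_nonneg_left (mul_le_mul_of_nonneg_left hεc₀ (by norm_num)) (Nat.cast_nonneg _)
    have hmodn : (m₃ n : ℝ) * (2 / (Real.sqrt (5 * n) * α₂ * modulus n)) ≤ θ / 2 := hmod
    nlinarith
  -- `h47` at this `n`
  -- the threshold inequality `hη`
  have hE := grid_estimation_error_le (q := q) (cD := cD) (c₃ := c₃) hn
  have hΔ : (lawCz (dim n + 1) (binaryIntLaw (modulus n) n)).tvDist
      (PMF.uniformOfFintype (Matrix (Fin (dim n + 1)) (Fin n) (ZMod (modulus n)) × (Fin (dim n + 1) → ZMod (modulus n)))) ≤ 1 / 8 :=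
    (tvDist_lawCz_binaryIntLaw_le (one_lt_modulus n) hε hlhl).trans hε8
  have hℓ : 2 * (sampleCount q m₃ cD c₃ n : ℝ) * (∑ p ∈ (modulus n).primeFactors, ((p : ℝ) ^ (dim n + 1))⁻¹ + 1 / (n : ℝ) ^ c₄₇) ≤ 1 / 4 := by
    rw [sum_primeFactors_modulus]; exact hell
  have hη := etaStar_admissible hmcount hE hΔ hℓ hraise
  have hηstar : 0 < etaStar q m₃ cD c₃ n := by unfold etaStar; positivity
  -- `hnoise` from Lemma 2.9 for the first hybrid (approach B)
  have hnoise : ∀ z ∈ (binaryIntLaw (modulus n) n).support,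
      (noiseH₁ (latticeNoiseLaw (invScaledBasisZ n (modulus n)) (Real.sqrt 5 * α₂))
          (discretizedGaussian (modulus n) (Real.sqrt (α₂ ^ 2 + (α₂ * Real.sqrt (5 * n - 1)) ^ 2)))
          (intCastVec z : Fin n → ZMod (modulus n))).tvDist
        (discretizedGaussian (modulus n) (binNoiseRate α n (intCastVec z))) ≤ 4 * ε := by
    intro z hz
    have hzb : ∀ j, z j = 0 ∨ z j = 1 := binaryIntLaw_support_binary (one_lt_modulus n) hz
    rw [sqrt_rate₂_sq_add_raise_sq hα₂.le hn, binNoiseRate_intCastVec_eq hzb]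
    exact tvDist_noiseH₁_invScaled_le_of_binary hε hε' (by positivity) hα₀ hzb hsmooth
  -- run the chain
  obtain ⟨Dn, hDn⟩ := section4_selected (n := n) (Q := modulus n) (q' := q n) (d := dim n) (r := r) (B := Real.sqrt n)
    (τ := gridTau (q n) ((q n : ℝ) * r * Real.sqrt n / √π) D G) (m₃ := m₃ n) (N := N) (N' := N) (mfel := mfel n) (θ := θ)
    (ε := ε) (α₀ := Real.sqrt (5 * n) * α₂) (α₂ := α₂) (u := α₂ * Real.sqrt (5 * n - 1)) (η₀ := 4 * ε) (L47 := 1 / (n : ℝ) ^ c₄₇)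
    (selRuns q m₃ cD c₃ n) hn hε hε' hr hα₀ hα₂ hG hN hN hm₃pos hθ hNsel K
    (latticeNoiseLaw (invScaledBasisZ n (modulus n)) (Real.sqrt 5 * α₂)) (fun s => binNoiseRate α n s)
    (binaryIntLaw (modulus n) n) (fun z hz => binaryIntLaw_support_binary (one_lt_modulus n) hz)
    hnoise hKz hεθ hQθ h47n hηstar hη
  exact ⟨Dn, (hfin hm₃pos).trans (le_trans (le_of_eq (selection_gain hmcount).symm) hDn)⟩

end Capstone

end BLPRS2013

end Literature.Computability.Cryptography

end
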